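import Literature.Topology.FourManifolds.TrisectionsSectorAtlas
import Literature.Topology.FourManifolds.MorseChartChange
import HarnessLib

/-!
# Morse data on a straightened sector: functions on a corner-slice atlas

Topic `Literature/Topology/FourManifolds`; infrastructure for the fact seat
`provefact-Literature.Topology.FourManifolds.exists_isBalancedGKTrisection` (Gay–Kirby 2016,
Thm. 4, existence of trisections, over the corrected predicate
`Literature.Topology.FourManifolds.IsGKTrisection` of `Trisections.lean`), seat 1, building on
seat 0's `TrisectionsSectorAtlas.lean` (the straightened smooth structure
`CornerSliceAtlas.chartedSpace` of a sector `S ⊆ M` with corners along `K`).  Everything in this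
file is **proved**; no named facts are introduced.

After `CornerSliceAtlas.sector_smooth_clause`, what clause (ii) of `IsGKTrisection` still asks of
a sector is compactness, connectedness and a **handle decomposition**
`Literature.Topology.FourManifolds.HasHandleDecomposition 3 ↥S (handleCount 1 k)`, i.e. a Morse
function on the straightened sector *adapted to its boundary*
(`Literature.Topology.FourManifolds.IsMorseAdapted`: `= 1` and regular on `∂`, `< 1` inside) with
prescribed numbers of critical points.  Such a function is obtained by restricting a function
`F` on the ambient manifold `M`; this file supplies the calculus of restrictions `F|_S` for the
structure `Φ.chartedSpace` (Milnor, *Morse theory* (1963), Thm. 3.1 and §3 — "`Mᵃ` is a smooth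
manifold with boundary" with the Morse data of `f|Mᵃ` — here for a domain whose angle along
`K` has been straightened):

* the preferred extended charts (`extChartAt_of_not_mem`, `extChartAt_of_mem`, …) and the
  restriction written in them (`writtenInExtChartAt_comp_val_eventuallyEq_of_not_mem`: `F ∘ Θₚ⁻¹`;
  `…_of_mem`: `F ∘ Θₚ⁻¹ ∘ cornerUnbend`);
* **off the corner locus** (`p ∉ K`, the inclusion is a `C^∞` immersion there):
  `contMDiffAt_comp_val_of_not_mem`, `mfderiv_comp_val_eq_of_not_mem`,
  `isMCriticalPt_comp_val_iff_of_not_mem` (critical points of `F|_S` = critical points of `F`),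
  and at *interior* critical points `mhessian_comp_val_eq_hessianInChart` (the Hessian of `F|_S`
  is the chart Hessian `Literature.Topology.FourManifolds.hessianInChart (𝓡 4) Θₚ F p` of
  `MorseChartChange.lean`), whence `nondegenerate_mhessian_comp_val_iff` and
  `morseIndex_comp_val_eq` by chart-independence of the Hessian at a critical point
  (Milnor 1963, §2);
* **on the corner locus** (`p ∈ K`): the inclusion is *not* smooth there (it reads
  `cornerUnbend` in charts), so `F|_S` is smooth at `p` only for `F` of *corner form*
  `G ∘ cornerFold ∘ Θₚ`, i.e. a smooth function of `(2uv, v² - u², tangential coordinates)`: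
  `contMDiffAt_comp_val_of_mem` (then `F|_S` reads `G`), `isMCriticalPt_comp_val_iff_of_mem`
  (`p` critical iff `dG = 0`), and for functions `ψ (u·v)` of the product of the normal
  coordinates `contMDiffAt_comp_val_of_eq_comp_mul`, `not_isMCriticalPt_comp_val_of_eq_comp_mul`
  (`ψ' (0) ≠ 0` ⇒ regular at `p`): **`1 - c·u·v` is a regular boundary-defining function of the
  straightened sector near `K`** (in the corner chart it is `1 - (c/2) x₀`);
* **assembly**: `isMorseAdapted_comp_val` — if `F` is smooth near `S ∖ K`, of corner form with
  `dG ≠ 0` along `S ∩ K`, `= 1` at the boundary points and `< 1` at the interior points of the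
  straightened sector, regular at the boundary points off `K` and with nondegenerate Hessian at
  its critical points interior to `S`, then `F|_S` is a Morse function adapted to `∂S`, whose
  critical points are exactly the interior points of `S` critical for `F`, with the same
  indices; `image_criticalSetOfIndex_comp_val`, and **`hasHandleDecomposition_of_comp_val`**:
  `HasHandleDecomposition 3 ↥S c` with `c i` the number of interior points of `S` that are
  critical points of `F` of index `i`.

For a sector of Gay–Kirby's construction (e.g. `X₁ = {f ≤ 3/2}` bevelled along the central
surface `F ⊂ f⁻¹(3/2)`) the intended `F` is the rescaled Morse function away from `F` patched,
inside the product neighbourhood of `F`, to `1 - c·u·v`; producing that patch without new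
critical points is the remaining, sector-specific step.

## References

* J. Milnor, *Morse theory*, Ann. of Math. Studies 51 (1963), §2 (critical points, Hessian and
  index in local coordinates), Thm. 3.1 and §3 (`Mᵃ` and the Morse data of `f|Mᵃ`). [Milnor1963]
* A. Douady, L. Hérault, *Arrondissement des variétés à coins*, appendix to A. Borel,
  J.-P. Serre, *Corners and arithmetic groups*, Comment. Math. Helv. 48 (1973) 436–491
  (functions on the straightened manifold). [DouadyHerault1973]
* D. Gay, R. Kirby, *Trisecting 4-manifolds*, Geom. Topol. 20 (2016) 3097–3132
  (arXiv:1205.1565), Def. 1 and §4, Lemma 14 (the sectors `X₁`, `X₂`, `X₃` are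
  `♮^k (S¹ × B³)`: handle decompositions of the sectors). [GayKirby2016]
-/

open scoped Manifold ContDiff Topology
open Set Function

noncomputable section

universe u

namespace Literature.Topology.FourManifolds

/-- Local notation: `𝔼⁴` is the model vector space `EuclideanSpace ℝ (Fin 4)`. -/
local notation "𝔼⁴" => EuclideanSpace ℝ (Fin 4)
/-- Local notation: `ℍ⁴` is the model half-space `EuclideanHalfSpace 4`. -/
local notation "ℍ⁴" => EuclideanHalfSpace 4

namespace CornerSliceAtlas

variable {M : Type u} [TopologicalSpace M] [ChartedSpace 𝔼⁴ M]
  {S K : Set M} {u v : M → ℝ} {π : M → M} (Φ : CornerSliceAtlas S K u v π)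

/-! ### The preferred extended charts of the straightened sector -/

/-- The preferred extended chart at a point off the corner locus is the extension of the chart
induced by the half-slice chart there (definitional). [folklore] -/
theorem extChartAt_of_not_mem (p : S) (hp : p.1 ∉ K) :
    letI := Φ.chartedSpace
    extChartAt (𝓡∂ 4) p = ((Φ.halfDatum p hp).chart p).extend (𝓡∂ 4) := by
  letI := Φ.chartedSpace
  show (chartAt ℍ⁴ p).extend (𝓡∂ 4) = _
  rw [Φ.chartAt_eq_of_not_mem p hp]

/-- The preferred extended chart at a point of the corner locus is the extension of the chart
induced by the corner-slice chart there (definitional). [folklore] -/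
theorem extChartAt_of_mem (p : S) (hp : p.1 ∈ K) :
    letI := Φ.chartedSpace
    extChartAt (𝓡∂ 4) p = ((Φ.cornerDatum p hp).chart p).extend (𝓡∂ 4) := by
  letI := Φ.chartedSpace
  show (chartAt ℍ⁴ p).extend (𝓡∂ 4) = _
  rw [Φ.chartAt_eq_of_mem p hp]

/-- The preferred extended chart at `p ∉ K`, evaluated at `p`, is `Θₚ p` for the half-slice
chart `Θₚ` at `p`. [folklore] -/
theorem extChartAt_self_of_not_mem (p : S) (hp : p.1 ∉ K) :
    letI := Φ.chartedSpace
    extChartAt (𝓡∂ 4) p p = (Φ.halfDatum p hp).Θ p.1 := by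
  letI := Φ.chartedSpace
  rw [Φ.extChartAt_of_not_mem p hp, (Φ.halfDatum p hp).extend_chart_apply (Φ.half_mem_source p hp)]

/-- The preferred extended chart at `p ∈ K`, evaluated at `p`, is `cornerFold (Θₚ p)` for the
corner-slice chart `Θₚ` at `p`. [folklore] -/
theorem extChartAt_self_of_mem (p : S) (hp : p.1 ∈ K) :
    letI := Φ.chartedSpace
    extChartAt (𝓡∂ 4) p p = cornerFold ((Φ.cornerDatum p hp).Θ p.1) := by
  letI := Φ.chartedSpace
  rw [Φ.extChartAt_of_mem p hp, (Φ.cornerDatum p hp).extend_chart_apply (Φ.corner_mem_source p hp)]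

/-- **A restriction read in the preferred chart off the corner locus.**  For `F : M → ℝ` and
`p ∉ K`, the function `F|_S` written in the preferred extended chart at `p` agrees with
`F ∘ Θₚ⁻¹` near `Θₚ p` within the half-space (`Θₚ` the half-slice chart at `p`). [folklore] -/
theorem writtenInExtChartAt_comp_val_eventuallyEq_of_not_mem (F : M → ℝ) (p : S) (hp : p.1 ∉ K) :
    letI := Φ.chartedSpace
    writtenInExtChartAt (𝓡∂ 4) 𝓘(ℝ, ℝ) p (F ∘ (Subtype.val : S → M))
      =ᶠ[𝓝[range (𝓡∂ 4)] ((Φ.halfDatum p hp).Θ p.1)] F ∘ (Φ.halfDatum p hp).Θ.symm := by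
  letI := Φ.chartedSpace
  set D := Φ.halfDatum p hp with hD
  have hmem : D.Θ.target ∈ 𝓝[range (𝓡∂ 4)] (D.Θ p.1) :=
    mem_nhdsWithin_of_mem_nhds (D.Θ.open_target.mem_nhds (D.Θ.map_source (Φ.half_mem_source p hp)))
  filter_upwards [hmem, self_mem_nhdsWithin] with z hz hzr
  rw [range_modelWithCornersEuclideanHalfSpace] at hzr
  have hz0 : 0 ≤ z 0 := hzr
  rw [writtenInExtChartAt_eq_comp_extend_symm]
  simp only [comp_apply]
  rw [Φ.chartAt_eq_of_not_mem p hp]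
  congr 1
  exact D.coe_extend_chart_symm_of_mem hz0 hz

/-- **A restriction read in the preferred chart on the corner locus.**  For `F : M → ℝ` and
`p ∈ K`, the function `F|_S` written in the preferred extended chart at `p` agrees with
`F ∘ Θₚ⁻¹ ∘ cornerUnbend` near `cornerFold (Θₚ p)` within the half-space (`Θₚ` the corner-slice
chart at `p`). [cite: DouadyHerault1973, Appendice] -/
theorem writtenInExtChartAt_comp_val_eventuallyEq_of_mem (F : M → ℝ) (p : S) (hp : p.1 ∈ K) :
    letI := Φ.chartedSpace
    writtenInExtChartAt (𝓡∂ 4) 𝓘(ℝ, ℝ) p (F ∘ (Subtype.val : S → M))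
      =ᶠ[𝓝[range (𝓡∂ 4)] (cornerFold ((Φ.cornerDatum p hp).Θ p.1))]
        F ∘ (Φ.cornerDatum p hp).Θ.symm ∘ cornerUnbend := by
  letI := Φ.chartedSpace
  set C := Φ.cornerDatum p hp with hC
  have hps := Φ.corner_mem_source p hp
  have hmem : cornerUnbend ⁻¹' C.Θ.target ∈ 𝓝[range (𝓡∂ 4)] (cornerFold (C.Θ p.1)) := by
    refine mem_nhdsWithin_of_mem_nhds ((C.Θ.open_target.preimage continuous_cornerUnbend).mem_nhds ?_)
    show cornerUnbend (cornerFold (C.Θ p.1)) ∈ C.Θ.target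
    rw [cornerUnbend_cornerFold (C.apply_mem_cornerQuadrant hps p.2)]
    exact C.Θ.map_source hps
  filter_upwards [hmem, self_mem_nhdsWithin] with z hz hzr
  rw [range_modelWithCornersEuclideanHalfSpace] at hzr
  have hz0 : 0 ≤ z 0 := hzr
  rw [writtenInExtChartAt_eq_comp_extend_symm]
  simp only [comp_apply]
  rw [Φ.chartAt_eq_of_mem p hp]
  congr 1
  exact C.coe_extend_chart_symm_of_mem hz0 hz

/-! ### Off the corner locus: smoothness, critical points, Hessians of a restriction -/

section OffCorner

variable [IsManifold (𝓡 4) ∞ M]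

/-- **Smoothness of a restriction off the corner locus**: if `F` is `C^n` at `p ∉ K` then
`F|_S` is `C^n` at `p` for the straightened structure (the inclusion is a `C^∞` immersion
there). [folklore] -/
theorem contMDiffAt_comp_val_of_not_mem {F : M → ℝ} (p : S) (hp : p.1 ∉ K)
    (hF : ContMDiffAt (𝓡 4) 𝓘(ℝ, ℝ) ∞ F p.1) :
    letI := Φ.chartedSpace
    ContMDiffAt (𝓡∂ 4) 𝓘(ℝ, ℝ) ∞ (F ∘ (Subtype.val : S → M)) p := by
  letI := Φ.chartedSpace
  haveI := Φ.isManifold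
  exact hF.comp p (Φ.isImmersionAt_subtype_val p hp).contMDiffAt

omit [IsManifold (𝓡 4) ∞ M] in
/-- **The differential of a restriction off the corner locus, read in the half-slice chart**:
`d(F|_S)(p) = d(F ∘ Θₚ⁻¹)(Θₚ p)` for `p ∉ K`. [folklore] -/
theorem mfderiv_comp_val_eq_of_not_mem {F : M → ℝ} (p : S) (hp : p.1 ∉ K)
    (hFS : letI := Φ.chartedSpace; MDifferentiableAt (𝓡∂ 4) 𝓘(ℝ, ℝ) (F ∘ (Subtype.val : S → M)) p)
    (hF : DifferentiableAt ℝ (F ∘ (Φ.halfDatum p hp).Θ.symm) ((Φ.halfDatum p hp).Θ p.1)) :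
    letI := Φ.chartedSpace
    mfderiv (𝓡∂ 4) 𝓘(ℝ, ℝ) (F ∘ (Subtype.val : S → M)) p =
      fderiv ℝ (F ∘ (Φ.halfDatum p hp).Θ.symm) ((Φ.halfDatum p hp).Θ p.1) := by
  letI := Φ.chartedSpace
  have h0 : 0 ≤ (Φ.halfDatum p hp).Θ p.1 0 :=
    (Φ.halfDatum p hp).apply_zero_nonneg (Φ.half_mem_source p hp) p.2
  rw [hFS.mfderiv, Φ.extChartAt_self_of_not_mem p hp,
    (Φ.writtenInExtChartAt_comp_val_eventuallyEq_of_not_mem F p hp).fderivWithin_eq_of_mem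
      (mem_range_modelHalf (k := 3) h0),
    hF.fderivWithin ((𝓡∂ 4).uniqueDiffOn _ (mem_range_modelHalf (k := 3) h0))]

/-- **Critical points of a restriction off the corner locus are those of the function**: for
`F` smooth at `p ∉ K`, `p` is a critical point of `F|_S` iff `p` is a critical point of `F`
(the inclusion is a local diffeomorphism onto its image there). [folklore] -/
theorem isMCriticalPt_comp_val_iff_of_not_mem {F : M → ℝ} (p : S) (hp : p.1 ∉ K)
    (hF : ContMDiffAt (𝓡 4) 𝓘(ℝ, ℝ) ∞ F p.1) :
    letI := Φ.chartedSpace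
    IsMCriticalPt (𝓡∂ 4) (F ∘ (Subtype.val : S → M)) p ↔ IsMCriticalPt (𝓡 4) F p.1 := by
  letI := Φ.chartedSpace
  haveI := Φ.isManifold
  have hps : p.1 ∈ (Φ.halfDatum p hp).Θ.source := Φ.half_mem_source p hp
  have hFd : MDifferentiableAt (𝓡 4) 𝓘(ℝ, ℝ) F p.1 := hF.mdifferentiableAt (by simp)
  -- `F ∘ Θ.symm` is smooth near `Θ p`
  have hFΘ : ContMDiffAt 𝓘(ℝ, 𝔼⁴) 𝓘(ℝ, ℝ) ∞ (F ∘ (Φ.halfDatum p hp).Θ.symm) ((Φ.halfDatum p hp).Θ p.1) := by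
    have h1 : ContMDiffAt 𝓘(ℝ, 𝔼⁴) (𝓡 4) ∞ (Φ.halfDatum p hp).Θ.symm ((Φ.halfDatum p hp).Θ p.1) :=
      ((Φ.halfDatum p hp).contMDiffOn_symm _ ((Φ.halfDatum p hp).Θ.map_source hps)).contMDiffAt
        ((Φ.halfDatum p hp).Θ.open_target.mem_nhds ((Φ.halfDatum p hp).Θ.map_source hps))
    have hF' : ContMDiffAt (𝓡 4) 𝓘(ℝ, ℝ) ∞ F ((Φ.halfDatum p hp).Θ.symm ((Φ.halfDatum p hp).Θ p.1)) := by
      rwa [(Φ.halfDatum p hp).Θ.left_inv hps]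
    exact hF'.comp _ h1
  have hFΘd : DifferentiableAt ℝ (F ∘ (Φ.halfDatum p hp).Θ.symm) ((Φ.halfDatum p hp).Θ p.1) :=
    (contMDiffAt_iff_contDiffAt.1 hFΘ).differentiableAt (by simp)
  have hFS : MDifferentiableAt (𝓡∂ 4) 𝓘(ℝ, ℝ) (F ∘ (Subtype.val : S → M)) p :=
    (Φ.contMDiffAt_comp_val_of_not_mem p hp hF).mdifferentiableAt (by simp)
  rw [IsMCriticalPt, Φ.mfderiv_comp_val_eq_of_not_mem p hp hFS hFΘd,
    isMCriticalPt_iff_fderiv_comp_symm_eq_zero (Φ.halfDatum p hp).contMDiffOn_toFun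
      (Φ.halfDatum p hp).contMDiffOn_symm hps hFd]
  exact Iff.rfl

omit [IsManifold (𝓡 4) ∞ M] in
/-- **The Hessian of a restriction at an interior point, read in the half-slice chart**: at an
interior point `p` of the straightened sector (so `p ∉ K` and `Θₚ p` lies in the open
half-space), the Hessian of `F|_S` is the second derivative of `F ∘ Θₚ⁻¹` at `Θₚ p`, i.e. the
chart Hessian `hessianInChart (𝓡 4) Θₚ F p` of `F` on `M` (`MorseChartChange.lean`).
[cite: Milnor1963, §2] -/
theorem mhessian_comp_val_eq_hessianInChart {F : M → ℝ} (p : S) (hp : p.1 ∉ K)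
    (hint : letI := Φ.chartedSpace; (𝓡∂ 4).IsInteriorPoint p) :
    letI := Φ.chartedSpace
    mhessian (𝓡∂ 4) (F ∘ (Subtype.val : S → M)) p = hessianInChart (𝓡 4) (Φ.halfDatum p hp).Θ F p.1 := by
  letI := Φ.chartedSpace
  set D := Φ.halfDatum p hp with hD
  set z₀ : 𝔼⁴ := D.Θ p.1 with hz₀
  have h0 : 0 < z₀ 0 := (Φ.isInteriorPoint_iff_of_not_mem p hp).1 hint
  have hHs : ∀ {z : 𝔼⁴}, 0 < z 0 → range (𝓡∂ 4) ∈ 𝓝 z := fun {z} hz => by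
    rw [range_modelWithCornersEuclideanHalfSpace]
    exact mem_interior_iff_mem_nhds.1 (by rw [interior_halfSpace]; exact hz)
  have hopen : IsOpen {z : 𝔼⁴ | 0 < z 0} := isOpen_lt continuous_const (PiLp.continuous_apply 2 _ 0)
  -- near `z₀` the written function is `F ∘ Θ.symm`, as germs for the full neighbourhood filter
  have hev : writtenInExtChartAt (𝓡∂ 4) 𝓘(ℝ, ℝ) p (F ∘ (Subtype.val : S → M)) =ᶠ[𝓝 z₀] F ∘ D.Θ.symm := by
    have h2 := Φ.writtenInExtChartAt_comp_val_eventuallyEq_of_not_mem F p hp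
    rwa [nhdsWithin_eq_nhds.2 (hHs h0)] at h2
  have hev' : writtenInExtChartAt (𝓡∂ 4) 𝓘(ℝ, ℝ) p (F ∘ (Subtype.val : S → M))
      =ᶠ[𝓝 z₀] fun z => (F ∘ D.Θ.symm) z + 0 :=
    hev.trans (Filter.Eventually.of_forall fun z => by simp)
  -- second derivatives within the half-space are plain second derivatives near `z₀`
  have hwithin : ∀ G : 𝔼⁴ → ℝ, fderivWithin ℝ (fderivWithin ℝ G (range (𝓡∂ 4))) (range (𝓡∂ 4)) z₀ =
      fderiv ℝ (fderiv ℝ G) z₀ := by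
    intro G
    have h1 : fderivWithin ℝ G (range (𝓡∂ 4)) =ᶠ[𝓝 z₀] fderiv ℝ G := by
      filter_upwards [hopen.mem_nhds h0] with z hz
      exact fderivWithin_of_mem_nhds (hHs hz)
    rw [h1.fderivWithin_eq_of_nhds, fderivWithin_of_mem_nhds (hHs h0)]
  ext a b
  rw [hessianInChart_apply_apply, mhessian]
  simp only [LinearMap.coe_comp, comp_apply, ContinuousLinearMap.coe_coe,
    ContinuousLinearMap.coeLM_apply]
  rw [Φ.extChartAt_self_of_not_mem p hp, fderivWithin_fderivWithin_eq_of_eventuallyEq_add_const hev',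
    hwithin]
  have hext : (F ∘ (D.Θ.extend (𝓡 4)).symm) = F ∘ D.Θ.symm := by
    ext z; simp
  have hpt : D.Θ.extend (𝓡 4) p.1 = z₀ := by simp [hz₀]
  rw [hext, hpt, ModelWithCorners.Boundaryless.range_eq_univ, fderivWithin_univ, fderivWithin_univ]

/-- **Nondegeneracy of the Hessian of a restriction at an interior critical point** is that
of the function: chart-independence of the Hessian at a critical point
(`nondegenerate_mhessian_iff`), the inclusion being a local diffeomorphism off `K`.
[cite: Milnor1963, §2] -/
theorem nondegenerate_mhessian_comp_val_iff {F : M → ℝ} (p : S) (hp : p.1 ∉ K)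
    (hint : letI := Φ.chartedSpace; (𝓡∂ 4).IsInteriorPoint p)
    (hF : ContMDiffAt (𝓡 4) 𝓘(ℝ, ℝ) ∞ F p.1) (hc : IsMCriticalPt (𝓡 4) F p.1) :
    letI := Φ.chartedSpace
    (mhessian (𝓡∂ 4) (F ∘ (Subtype.val : S → M)) p).Nondegenerate ↔ (mhessian (𝓡 4) F p.1).Nondegenerate := by
  letI := Φ.chartedSpace
  have he : (Φ.halfDatum p hp).Θ ∈ IsManifold.maximalAtlas (𝓡 4) 2 M :=
    IsManifold.maximalAtlas_subset_of_le (M := M) (I := 𝓡 4) ENat.LEInfty.out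
      (OpenPartialHomeomorph.mem_maximalAtlas_of_contMDiffOn (I := 𝓡 4) (n := ∞) _
        (Φ.halfDatum p hp).contMDiffOn_toFun (Φ.halfDatum p hp).contMDiffOn_symm)
  rw [Φ.mhessian_comp_val_eq_hessianInChart p hp hint,
    nondegenerate_mhessian_iff (hF.of_le ENat.LEInfty.out) hc he (Φ.half_mem_source p hp)]

/-- **The Morse index of a restriction at an interior critical point** is that of the function
(chart-independence of the index, `morseIndex_eq_sigNeg_hessianInChart`). [cite: Milnor1963, §2] -/
theorem morseIndex_comp_val_eq {F : M → ℝ} (p : S) (hp : p.1 ∉ K)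
    (hint : letI := Φ.chartedSpace; (𝓡∂ 4).IsInteriorPoint p)
    (hF : ContMDiffAt (𝓡 4) 𝓘(ℝ, ℝ) ∞ F p.1) (hc : IsMCriticalPt (𝓡 4) F p.1) :
    letI := Φ.chartedSpace
    morseIndex (𝓡∂ 4) (F ∘ (Subtype.val : S → M)) p = morseIndex (𝓡 4) F p.1 := by
  letI := Φ.chartedSpace
  have he : (Φ.halfDatum p hp).Θ ∈ IsManifold.maximalAtlas (𝓡 4) 2 M :=
    IsManifold.maximalAtlas_subset_of_le (M := M) (I := 𝓡 4) ENat.LEInfty.out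
      (OpenPartialHomeomorph.mem_maximalAtlas_of_contMDiffOn (I := 𝓡 4) (n := ∞) _
        (Φ.halfDatum p hp).contMDiffOn_toFun (Φ.halfDatum p hp).contMDiffOn_symm)
  rw [morseIndex, Φ.mhessian_comp_val_eq_hessianInChart p hp hint,
    ← morseIndex_eq_sigNeg_hessianInChart (hF.of_le ENat.LEInfty.out) hc he (Φ.half_mem_source p hp)]

end OffCorner

/-! ### On the corner locus: functions of corner form -/

section OnCorner

/-- In a corner-slice chart, the `0`-th coordinate of the folded chart is `2 u v`.
[cite: DouadyHerault1973, Appendice] -/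
theorem _root_.Literature.Topology.FourManifolds.CornerSliceChart.cornerFold_apply_zero_eq
    (C : CornerSliceChart S K u v π) {q : M} (hq : q ∈ C.Θ.source) :
    cornerFold (C.Θ q) 0 = 2 * u q * v q := by
  rw [cornerFold_apply_zero, C.apply_zero q hq, C.apply_one q hq]

/-- At a point of the corner locus the folded chart value has vanishing `0`-th coordinate.
[cite: DouadyHerault1973, Appendice] -/
theorem cornerFold_cornerDatum_apply_zero (p : S) (hp : p.1 ∈ K) :
    cornerFold ((Φ.cornerDatum p hp).Θ p.1) 0 = 0 := by
  have hps := Φ.corner_mem_source p hp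
  obtain ⟨h0, -⟩ := ((Φ.cornerDatum p hp).mem_K_iff_apply hps).1 hp
  rw [cornerFold_apply_zero, h0]; ring

/-- Near a point of the corner locus, within the half-space, `F ∘ Θₚ⁻¹ ∘ cornerUnbend` agrees
with `G` when `F = G ∘ cornerFold ∘ Θₚ` on `S` near `p`. [cite: DouadyHerault1973, Appendice] -/
theorem comp_symm_cornerUnbend_eventuallyEq_of_mem {F : M → ℝ} (p : S) (hp : p.1 ∈ K) {G : 𝔼⁴ → ℝ}
    (hFG : ∀ q ∈ (Φ.cornerDatum p hp).Θ.source, q ∈ S →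
      F q = G (cornerFold ((Φ.cornerDatum p hp).Θ q))) :
    (F ∘ (Φ.cornerDatum p hp).Θ.symm ∘ cornerUnbend)
      =ᶠ[𝓝[range (𝓡∂ 4)] (cornerFold ((Φ.cornerDatum p hp).Θ p.1))] G := by
  set C := Φ.cornerDatum p hp with hC
  have hps := Φ.corner_mem_source p hp
  have hmem : cornerUnbend ⁻¹' C.Θ.target ∈ 𝓝[range (𝓡∂ 4)] (cornerFold (C.Θ p.1)) := by
    refine mem_nhdsWithin_of_mem_nhds ((C.Θ.open_target.preimage continuous_cornerUnbend).mem_nhds ?_)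
    show cornerUnbend (cornerFold (C.Θ p.1)) ∈ C.Θ.target
    rw [cornerUnbend_cornerFold (C.apply_mem_cornerQuadrant hps p.2)]
    exact C.Θ.map_source hps
  filter_upwards [hmem, self_mem_nhdsWithin] with z hz hzr
  rw [range_modelWithCornersEuclideanHalfSpace] at hzr
  have hz0 : 0 ≤ z 0 := hzr
  have hzT : cornerUnbend z ∈ C.Θ.target := hz
  simp only [comp_apply]
  rw [hFG _ (C.Θ.map_target hzT) (C.symm_mem hzT (cornerUnbend_mem_cornerQuadrant z)),
    C.Θ.right_inv hzT, cornerFold_cornerUnbend hz0]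

/-- **Smoothness on the corner locus for functions of corner form.**  Let `p ∈ K` and `Θₚ` the
corner-slice chart at `p`.  If near `p` on `S` the function `F` is `G ∘ cornerFold ∘ Θₚ` with `G`
of class `C^n` within the half-space at `cornerFold (Θₚ p)` — i.e. `F` is a `C^n` function of
`(2 u v, v² - u², tangential coordinates)` — then `F|_S` is `C^n` at `p` for the straightened
structure (in the corner chart `F|_S` reads `G`).  By contrast a general smooth `F` on `M` is
*not* smooth on the straightened sector at `K` (in the corner chart it reads
`F ∘ Θₚ⁻¹ ∘ cornerUnbend`). [cite: DouadyHerault1973, Appendice] -/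
theorem contMDiffAt_comp_val_of_mem {n : ℕ∞ω} {F : M → ℝ} (p : S) (hp : p.1 ∈ K) {G : 𝔼⁴ → ℝ}
    (hG : ContDiffWithinAt ℝ n G {x | 0 ≤ x 0} (cornerFold ((Φ.cornerDatum p hp).Θ p.1)))
    (hFG : ∀ q ∈ (Φ.cornerDatum p hp).Θ.source, q ∈ S →
      F q = G (cornerFold ((Φ.cornerDatum p hp).Θ q))) :
    letI := Φ.chartedSpace
    ContMDiffAt (𝓡∂ 4) 𝓘(ℝ, ℝ) n (F ∘ (Subtype.val : S → M)) p := by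
  letI := Φ.chartedSpace
  set C := Φ.cornerDatum p hp with hC
  have hps := Φ.corner_mem_source p hp
  have hFp : F p.1 = G (cornerFold (C.Θ p.1)) := hFG _ hps p.2
  rw [contMDiffAt_iff]
  constructor
  · -- continuity
    have hsrc : Subtype.val ⁻¹' C.Θ.source ∈ 𝓝 p :=
      (C.Θ.open_source.preimage continuous_subtype_val).mem_nhds hps
    have hin : Filter.Tendsto (fun q : S => cornerFold (C.Θ q.1)) (𝓝 p)
        (𝓝[{x : 𝔼⁴ | 0 ≤ x 0}] (cornerFold (C.Θ p.1))) := by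
      rw [tendsto_nhdsWithin_iff]
      constructor
      · have hc : ContinuousAt (fun q : S => cornerFold (C.Θ q.1)) p :=
          continuous_cornerFold.continuousAt.comp
            ((C.Θ.continuousAt hps).comp continuous_subtype_val.continuousAt)
        exact hc.tendsto
      · filter_upwards [hsrc] with q hq
        exact cornerFold_apply_zero_nonneg (C.apply_mem_cornerQuadrant hq q.2)
    have hlim : Filter.Tendsto (fun q : S => G (cornerFold (C.Θ q.1))) (𝓝 p)
        (𝓝 (G (cornerFold (C.Θ p.1)))) :=
      hG.continuousWithinAt.tendsto.comp hin
    have hev : (fun q : S => G (cornerFold (C.Θ q.1))) =ᶠ[𝓝 p] (F ∘ (Subtype.val : S → M)) := by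
      filter_upwards [hsrc] with q hq
      exact (hFG q.1 hq q.2).symm
    have : ContinuousAt (fun q : S => G (cornerFold (C.Θ q.1))) p := by
      rw [ContinuousAt]; exact hlim
    have h2 := this.congr hev
    exact h2
  · -- the written function is `G` near `x₀` within the half-space
    change ContDiffWithinAt ℝ n (writtenInExtChartAt (𝓡∂ 4) 𝓘(ℝ, ℝ) p (F ∘ (Subtype.val : S → M)))
      (range (𝓡∂ 4)) (extChartAt (𝓡∂ 4) p p)
    rw [Φ.extChartAt_self_of_mem p hp]
    have hG' : ContDiffWithinAt ℝ n G (range (𝓡∂ 4)) (cornerFold (C.Θ p.1)) := by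
      rw [range_modelWithCornersEuclideanHalfSpace]; exact hG
    refine hG'.congr_of_eventuallyEq ?_ ?_
    · exact (Φ.writtenInExtChartAt_comp_val_eventuallyEq_of_mem F p hp).trans
        (Φ.comp_symm_cornerUnbend_eventuallyEq_of_mem p hp hFG)
    · -- value at the base point
      have hval : writtenInExtChartAt (𝓡∂ 4) 𝓘(ℝ, ℝ) p (F ∘ (Subtype.val : S → M)) (extChartAt (𝓡∂ 4) p p) = F p.1 := by
        simp only [writtenInExtChartAt, comp_apply, extChartAt_to_inv]
        simp
      rw [Φ.extChartAt_self_of_mem p hp] at hval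
      rw [hval, hFp]

/-- **Critical points on the corner locus for functions of corner form**: with `F`, `G` as in
`contMDiffAt_comp_val_of_mem` and `G` differentiable at `x₀ = cornerFold (Θₚ p)` (on a full
neighbourhood), `p` is a critical point of `F|_S` iff `dG(x₀) = 0`.  In particular
`F = 1 - c·u·v` (`G = 1 - (c/2) x₀`) restricts to a *regular* boundary-defining function of
the straightened sector near `K`. [cite: DouadyHerault1973, Appendice] -/
theorem isMCriticalPt_comp_val_iff_of_mem {F : M → ℝ} (p : S) (hp : p.1 ∈ K) {G : 𝔼⁴ → ℝ}
    (hG : ContDiffAt ℝ 1 G (cornerFold ((Φ.cornerDatum p hp).Θ p.1)))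
    (hFG : ∀ q ∈ (Φ.cornerDatum p hp).Θ.source, q ∈ S →
      F q = G (cornerFold ((Φ.cornerDatum p hp).Θ q))) :
    letI := Φ.chartedSpace
    IsMCriticalPt (𝓡∂ 4) (F ∘ (Subtype.val : S → M)) p ↔
      fderiv ℝ G (cornerFold ((Φ.cornerDatum p hp).Θ p.1)) = 0 := by
  letI := Φ.chartedSpace
  set x₀ := cornerFold ((Φ.cornerDatum p hp).Θ p.1) with hx₀
  have hx₀r : x₀ ∈ range (𝓡∂ 4) := by
    rw [range_modelWithCornersEuclideanHalfSpace]
    exact cornerFold_apply_zero_nonneg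
      ((Φ.cornerDatum p hp).apply_mem_cornerQuadrant (Φ.corner_mem_source p hp) p.2)
  have hsm : ContMDiffAt (𝓡∂ 4) 𝓘(ℝ, ℝ) 1 (F ∘ (Subtype.val : S → M)) p :=
    Φ.contMDiffAt_comp_val_of_mem p hp hG.contDiffWithinAt hFG
  have hd : MDifferentiableAt (𝓡∂ 4) 𝓘(ℝ, ℝ) (F ∘ (Subtype.val : S → M)) p := hsm.mdifferentiableAt one_ne_zero
  have hev : writtenInExtChartAt (𝓡∂ 4) 𝓘(ℝ, ℝ) p (F ∘ (Subtype.val : S → M)) =ᶠ[𝓝[range (𝓡∂ 4)] x₀] G :=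
    (Φ.writtenInExtChartAt_comp_val_eventuallyEq_of_mem F p hp).trans
      (Φ.comp_symm_cornerUnbend_eventuallyEq_of_mem p hp hFG)
  rw [IsMCriticalPt, hd.mfderiv, Φ.extChartAt_self_of_mem p hp, hev.fderivWithin_eq_of_mem hx₀r,
    (hG.differentiableAt one_ne_zero).fderivWithin ((𝓡∂ 4).uniqueDiffOn _ hx₀r)]
  exact Iff.rfl

/-- **Functions of the product `u v` near the corner locus** are of corner form: if
`F = ψ (u v)` on `S` near `p ∈ K` with `ψ : ℝ → ℝ` of class `C^n`, then `F|_S` is `C^n` at `p`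
(`u v = x₀ / 2` in the corner chart). [cite: DouadyHerault1973, Appendice] -/
theorem contMDiffAt_comp_val_of_eq_comp_mul {n : ℕ∞ω} {F : M → ℝ} (p : S) (hp : p.1 ∈ K)
    {ψ : ℝ → ℝ} (hψ : ContDiff ℝ n ψ)
    (hF : ∀ q ∈ (Φ.cornerDatum p hp).Θ.source, q ∈ S → F q = ψ (u q * v q)) :
    letI := Φ.chartedSpace
    ContMDiffAt (𝓡∂ 4) 𝓘(ℝ, ℝ) n (F ∘ (Subtype.val : S → M)) p := by
  have hG : ContDiff ℝ n fun x : 𝔼⁴ => ψ (x 0 * 2⁻¹) :=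
    hψ.comp ((contDiff_euclidean.mp contDiff_id 0).mul contDiff_const)
  refine Φ.contMDiffAt_comp_val_of_mem p hp hG.contDiffAt.contDiffWithinAt fun q hq hqS => ?_
  rw [hF q hq hqS, (Φ.cornerDatum p hp).cornerFold_apply_zero_eq hq]
  ring_nf

/-- **`ψ (u v)` is regular on the corner locus when `ψ' (0) ≠ 0`**: e.g. the boundary-defining
function `1 - c·u·v` (`c ≠ 0`) of a bevelled sector has no critical point on `K` for the
straightened structure. [cite: DouadyHerault1973, Appendice] -/
theorem not_isMCriticalPt_comp_val_of_eq_comp_mul {F : M → ℝ} (p : S) (hp : p.1 ∈ K)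
    {ψ : ℝ → ℝ} (hψ : ContDiff ℝ 1 ψ) (hψ' : deriv ψ 0 ≠ 0)
    (hF : ∀ q ∈ (Φ.cornerDatum p hp).Θ.source, q ∈ S → F q = ψ (u q * v q)) :
    letI := Φ.chartedSpace
    ¬ IsMCriticalPt (𝓡∂ 4) (F ∘ (Subtype.val : S → M)) p := by
  letI := Φ.chartedSpace
  have hx₀0 : cornerFold ((Φ.cornerDatum p hp).Θ p.1) 0 = 0 := Φ.cornerFold_cornerDatum_apply_zero p hp
  have hG : ContDiff ℝ 1 fun x : 𝔼⁴ => ψ (x 0 * 2⁻¹) :=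
    hψ.comp ((contDiff_euclidean.mp contDiff_id 0).mul contDiff_const)
  have hFG : ∀ q ∈ (Φ.cornerDatum p hp).Θ.source, q ∈ S →
      F q = (fun x : 𝔼⁴ => ψ (x 0 * 2⁻¹)) (cornerFold ((Φ.cornerDatum p hp).Θ q)) := by
    intro q hq hqS
    simp only
    rw [hF q hq hqS, (Φ.cornerDatum p hp).cornerFold_apply_zero_eq hq]
    ring_nf
  rw [Φ.isMCriticalPt_comp_val_iff_of_mem p hp hG.contDiffAt hFG]
  -- `dG(x₀) e₀ = ψ' (0) / 2 ≠ 0`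
  have hproj : HasFDerivAt (fun x : 𝔼⁴ => x 0 * 2⁻¹)
      ((2 : ℝ)⁻¹ • (EuclideanSpace.proj (0 : Fin 4) : 𝔼⁴ →L[ℝ] ℝ))
      (cornerFold ((Φ.cornerDatum p hp).Θ p.1)) :=
    (EuclideanSpace.proj (0 : Fin 4) : 𝔼⁴ →L[ℝ] ℝ).hasFDerivAt.mul_const (2 : ℝ)⁻¹
  have hψd : HasDerivAt ψ (deriv ψ 0) (cornerFold ((Φ.cornerDatum p hp).Θ p.1) 0 * 2⁻¹) := by
    rw [hx₀0, zero_mul]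
    exact (hψ.differentiable one_ne_zero 0).hasDerivAt
  have hGd : HasFDerivAt (fun x : 𝔼⁴ => ψ (x 0 * 2⁻¹))
      (deriv ψ 0 • ((2 : ℝ)⁻¹ • (EuclideanSpace.proj (0 : Fin 4) : 𝔼⁴ →L[ℝ] ℝ)))
      (cornerFold ((Φ.cornerDatum p hp).Θ p.1)) :=
    hψd.comp_hasFDerivAt (cornerFold ((Φ.cornerDatum p hp).Θ p.1)) hproj
  rw [hGd.fderiv]
  intro h
  have := congrArg (fun L : 𝔼⁴ →L[ℝ] ℝ => L (EuclideanSpace.single (0 : Fin 4) 1)) h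
  simp at this
  exact hψ' this

end OnCorner

/-! ### Morse functions adapted to the boundary of a straightened sector -/

section Adapted

variable [IsManifold (𝓡 4) ∞ M]

omit [IsManifold (𝓡 4) ∞ M] in
/-- Interior points of the straightened sector are off the corner locus. [folklore] -/
theorem not_mem_of_isInteriorPoint (p : S) (hp : letI := Φ.chartedSpace; (𝓡∂ 4).IsInteriorPoint p) :
    p.1 ∉ K := by
  letI := Φ.chartedSpace
  intro hK
  exact ((𝓡∂ 4).isInteriorPoint_iff_not_isBoundaryPoint p).1 hp (Φ.isBoundaryPoint_of_mem p hK)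

/-- **Morse functions adapted to the boundary of a straightened sector.**  Let `Φ` be a
corner-slice atlas for `(S, K)` and `F : M → ℝ` a function which is smooth near `S ∖ K`, of
*corner form* `G ∘ cornerFold ∘ Θₚ` with `dG ≠ 0` at each point `p` of `S ∩ K`, equal to `1`
at the boundary points of the straightened sector and `< 1` at its interior points, without
critical points at the boundary points off `K`, and with nondegenerate Hessian at its critical
points interior to `S`.  Then `F|_S` is a Morse function adapted to the boundary of the
straightened sector (`Literature.Topology.FourManifolds.IsMorseAdapted`), its critical points
are exactly the interior points of `S` that are critical for `F`, with the same Morse indices.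
This is the form in which the handle decomposition required by clause (ii) of
`Literature.Topology.FourManifolds.IsGKTrisection` is obtained for a bevelled sector (Milnor
1963, §3: `Mᵃ` and its Morse function; here with the angle along `K` straightened).
[cite: Milnor1963, Thm. 3.1] -/
theorem isMorseAdapted_comp_val {F : M → ℝ}
    (hFs : ∀ q ∈ S, q ∉ K → ContMDiffAt (𝓡 4) 𝓘(ℝ, ℝ) ∞ F q)
    (hFc : ∀ (p : S) (hp : p.1 ∈ K), ∃ G : 𝔼⁴ → ℝ,
      ContDiffAt ℝ ∞ G (cornerFold ((Φ.cornerDatum p hp).Θ p.1)) ∧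
      fderiv ℝ G (cornerFold ((Φ.cornerDatum p hp).Θ p.1)) ≠ 0 ∧
      ∀ q ∈ (Φ.cornerDatum p hp).Θ.source, q ∈ S → F q = G (cornerFold ((Φ.cornerDatum p hp).Θ q)))
    (hb1 : letI := Φ.chartedSpace; ∀ p : S, (𝓡∂ 4).IsBoundaryPoint p → F p.1 = 1)
    (hb2 : letI := Φ.chartedSpace; ∀ p : S, (𝓡∂ 4).IsBoundaryPoint p → p.1 ∉ K →
      ¬ IsMCriticalPt (𝓡 4) F p.1)
    (hi1 : letI := Φ.chartedSpace; ∀ p : S, (𝓡∂ 4).IsInteriorPoint p → F p.1 < 1)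
    (hi2 : letI := Φ.chartedSpace; ∀ p : S, (𝓡∂ 4).IsInteriorPoint p → IsMCriticalPt (𝓡 4) F p.1 →
      (mhessian (𝓡 4) F p.1).Nondegenerate) :
    letI := Φ.chartedSpace
    IsMorseAdapted (𝓡∂ 4) (F ∘ (Subtype.val : S → M)) ∧
      (∀ p : S, IsMCriticalPt (𝓡∂ 4) (F ∘ (Subtype.val : S → M)) p ↔
        (𝓡∂ 4).IsInteriorPoint p ∧ IsMCriticalPt (𝓡 4) F p.1) ∧
      (∀ p : S, (𝓡∂ 4).IsInteriorPoint p → IsMCriticalPt (𝓡 4) F p.1 →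
        morseIndex (𝓡∂ 4) (F ∘ (Subtype.val : S → M)) p = morseIndex (𝓡 4) F p.1) := by
  letI := Φ.chartedSpace
  haveI := Φ.isManifold
  -- smoothness everywhere
  have hsmooth : ContMDiff (𝓡∂ 4) 𝓘(ℝ, ℝ) ∞ (F ∘ (Subtype.val : S → M)) := by
    intro p
    by_cases hp : p.1 ∈ K
    · obtain ⟨G, hG, -, hFG⟩ := hFc p hp
      exact Φ.contMDiffAt_comp_val_of_mem p hp hG.contDiffWithinAt hFG
    · exact Φ.contMDiffAt_comp_val_of_not_mem p hp (hFs p.1 p.2 hp)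
  -- critical points
  have hcrit : ∀ p : S, IsMCriticalPt (𝓡∂ 4) (F ∘ (Subtype.val : S → M)) p ↔
      (𝓡∂ 4).IsInteriorPoint p ∧ IsMCriticalPt (𝓡 4) F p.1 := by
    intro p
    by_cases hp : p.1 ∈ K
    · obtain ⟨G, hG, hG', hFG⟩ := hFc p hp
      rw [Φ.isMCriticalPt_comp_val_iff_of_mem p hp (hG.of_le ENat.LEInfty.out) hFG]
      constructor
      · intro h; exact absurd h hG'
      · rintro ⟨hint, -⟩
        exact absurd hp (Φ.not_mem_of_isInteriorPoint p hint)
    · rw [Φ.isMCriticalPt_comp_val_iff_of_not_mem p hp (hFs p.1 p.2 hp)]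
      constructor
      · intro hc
        refine ⟨?_, hc⟩
        by_contra hni
        have hb : (𝓡∂ 4).IsBoundaryPoint p :=
          ((𝓡∂ 4).isBoundaryPoint_iff_not_isInteriorPoint p).2 hni
        exact hb2 p hb hp hc
      · exact fun h => h.2
  refine ⟨⟨⟨hsmooth, fun p hp => ?_⟩, fun p hp => ⟨hb1 p hp, fun hc => ?_⟩, fun p hp => hi1 p hp⟩,
    hcrit, fun p hint hc => ?_⟩
  · -- nondegenerate Hessian at critical points (interior)
    obtain ⟨hint, hc⟩ := (hcrit p).1 hp
    have hpK := Φ.not_mem_of_isInteriorPoint p hint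
    exact (Φ.nondegenerate_mhessian_comp_val_iff p hpK hint (hFs p.1 p.2 hpK) hc).2 (hi2 p hint hc)
  · -- no critical points on the boundary
    obtain ⟨hint, -⟩ := (hcrit p).1 hc
    exact ((𝓡∂ 4).isInteriorPoint_iff_not_isBoundaryPoint p).1 hint hp
  · -- indices
    have hpK := Φ.not_mem_of_isInteriorPoint p hint
    exact Φ.morseIndex_comp_val_eq p hpK hint (hFs p.1 p.2 hpK) hc

/-- **Counting the critical points of `F|_S`**: under the hypotheses of
`isMorseAdapted_comp_val`, the critical points of `F|_S` of index `i` are carried by the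
inclusion exactly onto the points of `S`, interior for the straightened structure, that are
critical points of `F` of index `i`; so the counts agree. [cite: Milnor1963, Thm. 3.1 and §3] -/
theorem image_criticalSetOfIndex_comp_val {F : M → ℝ}
    (hFs : ∀ q ∈ S, q ∉ K → ContMDiffAt (𝓡 4) 𝓘(ℝ, ℝ) ∞ F q)
    (hFc : ∀ (p : S) (hp : p.1 ∈ K), ∃ G : 𝔼⁴ → ℝ,
      ContDiffAt ℝ ∞ G (cornerFold ((Φ.cornerDatum p hp).Θ p.1)) ∧
      fderiv ℝ G (cornerFold ((Φ.cornerDatum p hp).Θ p.1)) ≠ 0 ∧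
      ∀ q ∈ (Φ.cornerDatum p hp).Θ.source, q ∈ S → F q = G (cornerFold ((Φ.cornerDatum p hp).Θ q)))
    (hb1 : letI := Φ.chartedSpace; ∀ p : S, (𝓡∂ 4).IsBoundaryPoint p → F p.1 = 1)
    (hb2 : letI := Φ.chartedSpace; ∀ p : S, (𝓡∂ 4).IsBoundaryPoint p → p.1 ∉ K →
      ¬ IsMCriticalPt (𝓡 4) F p.1)
    (hi1 : letI := Φ.chartedSpace; ∀ p : S, (𝓡∂ 4).IsInteriorPoint p → F p.1 < 1)
    (hi2 : letI := Φ.chartedSpace; ∀ p : S, (𝓡∂ 4).IsInteriorPoint p → IsMCriticalPt (𝓡 4) F p.1 →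
      (mhessian (𝓡 4) F p.1).Nondegenerate) (i : ℕ) :
    letI := Φ.chartedSpace
    (Subtype.val : S → M) '' criticalSetOfIndex (𝓡∂ 4) (F ∘ (Subtype.val : S → M)) i =
      (Subtype.val : S → M) '' ((𝓡∂ 4).interior S) ∩ criticalSetOfIndex (𝓡 4) F i := by
  letI := Φ.chartedSpace
  obtain ⟨-, hcrit, hidx⟩ := Φ.isMorseAdapted_comp_val hFs hFc hb1 hb2 hi1 hi2
  ext x
  simp only [mem_image, mem_criticalSetOfIndex, mem_inter_iff]
  constructor
  · rintro ⟨p, ⟨hp1, hp2⟩, rfl⟩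
    obtain ⟨hint, hc⟩ := (hcrit p).1 hp1
    exact ⟨⟨p, hint, rfl⟩, hc, by rw [← hidx p hint hc]; exact hp2⟩
  · rintro ⟨⟨p, hint, rfl⟩, hc, hi⟩
    refine ⟨p, ⟨(hcrit p).2 ⟨hint, hc⟩, ?_⟩, rfl⟩
    rw [hidx p hint hc]; exact hi

/-- **Handle decomposition of a straightened sector from a function on the ambient manifold.**
Under the hypotheses of `isMorseAdapted_comp_val`, the straightened sector `S` has a handle
decomposition (`Literature.Topology.FourManifolds.HasHandleDecomposition 3 S c`) with `c i` the
number of points of `S`, interior for the straightened structure, that are critical points of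
`F` of index `i`.  With `c =
handleCount 1 k` this is the handle-decomposition item of clause (ii) of `IsGKTrisection`.
[cite: Milnor1963, Thm. 3.1 and §3] -/
theorem hasHandleDecomposition_of_comp_val {F : M → ℝ}
    (hFs : ∀ q ∈ S, q ∉ K → ContMDiffAt (𝓡 4) 𝓘(ℝ, ℝ) ∞ F q)
    (hFc : ∀ (p : S) (hp : p.1 ∈ K), ∃ G : 𝔼⁴ → ℝ,
      ContDiffAt ℝ ∞ G (cornerFold ((Φ.cornerDatum p hp).Θ p.1)) ∧
      fderiv ℝ G (cornerFold ((Φ.cornerDatum p hp).Θ p.1)) ≠ 0 ∧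
      ∀ q ∈ (Φ.cornerDatum p hp).Θ.source, q ∈ S → F q = G (cornerFold ((Φ.cornerDatum p hp).Θ q)))
    (hb1 : letI := Φ.chartedSpace; ∀ p : S, (𝓡∂ 4).IsBoundaryPoint p → F p.1 = 1)
    (hb2 : letI := Φ.chartedSpace; ∀ p : S, (𝓡∂ 4).IsBoundaryPoint p → p.1 ∉ K →
      ¬ IsMCriticalPt (𝓡 4) F p.1)
    (hi1 : letI := Φ.chartedSpace; ∀ p : S, (𝓡∂ 4).IsInteriorPoint p → F p.1 < 1)
    (hi2 : letI := Φ.chartedSpace; ∀ p : S, (𝓡∂ 4).IsInteriorPoint p → IsMCriticalPt (𝓡 4) F p.1 →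
      (mhessian (𝓡 4) F p.1).Nondegenerate)
    {c : ℕ → ℕ}
    (hc : letI := Φ.chartedSpace; ∀ i,
      ((Subtype.val : S → M) '' ((𝓡∂ 4).interior S) ∩ criticalSetOfIndex (𝓡 4) F i).ncard = c i) :
    letI := Φ.chartedSpace
    HasHandleDecomposition 3 S c := by
  letI := Φ.chartedSpace
  refine ⟨F ∘ Subtype.val, (Φ.isMorseAdapted_comp_val hFs hFc hb1 hb2 hi1 hi2).1, fun i => ?_⟩
  show (criticalSetOfIndex (𝓡∂ 4) (F ∘ (Subtype.val : S → M)) i).ncard = c i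
  rw [← hc i, ← Φ.image_criticalSetOfIndex_comp_val hFs hFc hb1 hb2 hi1 hi2 i,
    Set.ncard_image_of_injective _ Subtype.val_injective]

end Adapted

end CornerSliceAtlas

end Literature.Topology.FourManifolds

end
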